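import Literature.MathematicalPhysics.QuantumFieldTheory.Balaban1983to89.B7Prop3GeneralLinearBound
import Literature.MathematicalPhysics.QuantumFieldTheory.Balaban1983to89.B7BlockGeometry

/-!
# Bałaban's renormalization group for 4-d lattice Yang–Mills — B7 Proposition 5, (139) AT A GENERAL BACKGROUND,
file 1: PATH MASSES — the rotated contour sums `(R_{0,y}A)(Γ)` are majorised by the `ℓ¹` mass `Σ_{b⊂Γ}|A_b|` of the
contour, and the contours of (115)∕(124)∕(125) (tree contours `Γ_{c±,x}`, straight segments `[x, x(c)]`, the bond `c`)
carry their mass inside `B(c₋) ∪ B(c₊)`, i.e. inside the index set of print's `Q″` (140) (`ShellMeasureAveragePathMass`; cell `pub-balaban`, sub-cell `t4`, NE7c ROUND-2 crew row S68 (a), file 1∕2)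

PLACEMENT.  OUR bookkeeping toward a printed inequality ⇒ `Summits/…/Support/` (placement rule 2026-08-19); the printed
statement (139) carries `[cite:]` LOCATOR tags in file 2's docstrings, nothing printed is asserted.  Seat
`b2b-balaban-t4-ne7c-formalise-leaf-05` gen 7; owner table row S68 (a) «[B7] PROP. 5 — (139) IN MAJORANT FORM AT A GENERAL
REGULAR BACKGROUND», booked by owner gen 30 on leaf-10-g9's Proposition-5 cut).  Source: T. Bałaban, *Averaging operations
for lattice gauge theories*, Commun. Math. Phys. **98**, 17–51 (1985) [Balaban1985Averaging] (cell paper B7; journal page =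
PDF page + 16), p. 39 [PDF 23] ((139)–(140)), quoted from the page render
`b2b-balaban-ref1/pages/1985-cmp98-averaging/1985-cmp98-averaging-p023-x2.png` READ AS AN IMAGE by this seat (2026-08-20);
(124)–(126) p. 36, (115) p. 34, (14) p. 19 through the lineage's quotations (`B7Prop3GeneralLinearBound`,
`B7Prop3GeneralLinearSplit`, `B7Prop1Explicit`); [2] = T. Bałaban, *Propagators and renormalization transformations for
lattice gauge theories. I*, Commun. Math. Phys. **95**, 17–40 (1984) [Balaban1984PropagatorsI], (1.8)∕(1.11) p. 19 through
`B7BlockGeometry`'s quotation.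

THE PRINTED TEXT (verbatim, p. 39).  "We would like to prove that the functional derivative of Q_k(U₀, ηA) is bounded
by a constant independent of η. This property is not clear even for the linear part of Q_k, so let us start with an
analysis of this linear part. The linear part of the one-step renormalization transformation is given by the formula
(124). It is a sum of the main term Q_{V₀}A given by (125) and a remainder which we will denote by Q″(V₀)A. From (124) it
is clear that we have the inequalities |Q_{V₀}A| ≦ Q|A|, |Q″(V₀)A| ≦ C′₁L²α₀Q″|A|, (139) where the operator Q is defined as
in [2], and Q″ is defined as (Q″A)_c = Σ_{b⊂B(c₋)∪B(c₊)} L^{−d}A_b. (140) The constant C′₁ depends on d and L."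

DICTIONARY.  «From (124) it is clear»: the remainder terms of (124) are `[operator − 1] = O(L²α₀)` acting on the rotated
contour sums `(R_{0,·}A)(Γ)` of the loop `Γ_{c,x} ∪ (−c)` and of `Γ_{c₊,x′}`, `c` (`B7Prop3GeneralLinearSplit.linQcov_split`,
`Aloop_eq`); to majorise them by `Q″|A|` instead of `sup|A|` one needs (i) `‖(R_{0,y}A)(Γ)‖ ≤ Σ_{b⊂Γ}|A_b|` (rotations in
`U1` are norm-non-increasing) and (ii) that every such `Γ` is a monotone walk whose bonds are DISTINCT members of
`{b ⊂ B(c₋) ∪ B(c₊)}` = `B7BlockGeometry.qppBonds L c`.  The coarse bond `c = (y, κ) : ZdEdge d` has fine corner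
`c₋ = blockBase L y = L·y` (b07's `q`), `c₊ = L·y + Le_κ`; `|A|` is the bond function `b ↦ ‖A b.1 b.2‖`.

WHAT THIS FILE PROVES (kernel, no `sorry`; [folklore] finite combinatorics, the content print leaves in «it is clear»):
* §1 `pmass A x Γ` = `Σ_{b⊂Γ}|A_b|` along the word (DATA), `pmass_append`, **`norm_tsum_le_pmass`** (`U1` background).
* §2 `bondsOf` (DATA: the bonds of a walk), `bondsOf_pos` (a positively oriented walk from `x` stays in the box
  `[x, x + disp Γ]`), `head_not_mem_bondsOf`, **`pmass_le_sum`** (`pmass ≤ Σ_{b∈T}|A_b|` for any bond set `T` covering the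
  walk — its bonds are pairwise distinct).
* §3 the pieces: `bondsOf_treeWord_mem` ∕ `bondsOf_seg_mem` (tree contours and straight segments lie in `qppBonds L c`,
  via `QuantumLattice.blockMap_blockBase_add_of_lt` and `B7BlockGeometry.line_mem_twoBlocks`), `sum_qppBonds_eq_Qdd`
  (`Σ_{b∈qppBonds}|A_b| = Lᵈ·(Q″|A|)_c`), **`pmass_treeWord_le`∕`pmass_treeWord_le'`∕`pmass_seg_le`** (each piece's mass
  `≤ Σ_{b⊂B(c₋)∪B(c₊)}|A_b|`), `pmass_replicate` (the segment's mass explicitly).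
File 2 `ShellMeasureAverageMajorant`: (139) itself.
ABSOLUTE-RULE LEDGER.  No hypotheses beyond `U1` and `0 < L`; no `B7.Prop*` placeholder, no `def … : Prop`, nothing of
the manuscript cited as a fact; new DATA defs `bsite`, `pmass`, `bondsOf` only.
HONEST FRAMING (cell).  A LITERATURE REPRODUCTION feeding the NE7c ROUND-2 crew's row S68 (a) (owner table
`t4/b2b-balaban-t4-ne7c-p1/LEAVES-NE7c-P1.md`; W-a (Cf′) input of [Balaban1985Variational] (72)→(73)); nothing of Bałaban's
live-level estimates is discharged; NE7c NOT PRINTED, NOT PROVED; spine PROVED 0∕9; rung (B)+1 on a finite T⁴ — NOT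
infinite volume, NOT mass gap, NOT Clay.  HONEST DEPENDENCY: continuum YM on T⁴ ⇐ BetaPertH ∧ nine spine estimates (0/9
proved); BetaPertH ⇐ (D1) ∧ (D4) ∧ CAP+tail; G-an2-4 gates asym, D1 and NE2/3/4.
-/

noncomputable section

open scoped BigOperators
open NormedSpace Finset

namespace Summit.QuantumFields.BalabanUV.T4Continuum.ShellMeasureAveragePathMass

open Literature.MathematicalPhysics.QuantumFieldTheory.Balaban1983to89

open Literature.MathematicalPhysics.QuantumLattice (ZdEdge blockMap blockBase blockSites mem_blockSites_iff
  blockMap_blockBase_add_of_lt)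
open B7Prop1Explicit B7Prop3GeneralRotated
open B7Eq78Linearization (conjR conjR_apply)
open B7BlockGeometry (Qav Qdd Qav_apply Qdd_apply' qppBonds mem_qppBonds twoBlocks line_mem_twoBlocks)

-- `Site` alone would resolve to the torus sites of `Setup.lean`; re-export the `ℤ^d` sites of `B7Prop1Explicit`.
export B7Prop1Explicit (Site)

variable {d : ℕ}

/-! ## §1 The `ℓ¹` mass of a contour and the majorisation of the rotated sums -/

section Mass

variable {𝔸 : Type*} [NormedRing 𝔸]

/-- The site carrying the bond traversed by the letter `l` from `x`: `x` itself for a positively oriented letter,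
`x − e_μ` for a reversed one (convention (9)). [folklore] -/
def bsite (x : Site d) (l : Letter d) : Site d := if l.2 then x else x + l.vec

/-- THE `ℓ¹` MASS of the contour `Γ` walked from `x`: `Σ_{b⊂Γ} |A_b|` with multiplicity (B5 (1.8) «A(Γ) = Σ_{b⊂Γ} A_b»
with `|A_b|` in place of `A_b`). [folklore] -/
def pmass (A : Site d → Fin d → 𝔸) : Site d → List (Letter d) → ℝ
  | _, [] => 0
  | x, l :: w => ‖A (bsite x l) l.1‖ + pmass A (x + l.vec) w

/-- Empty contour. [folklore] -/
@[simp] theorem pmass_nil (A : Site d → Fin d → 𝔸) (x : Site d) : pmass A x [] = 0 := rfl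

/-- One letter. [folklore] -/
@[simp] theorem pmass_cons (A : Site d → Fin d → 𝔸) (x : Site d) (l : Letter d) (w : List (Letter d)) :
    pmass A x (l :: w) = ‖A (bsite x l) l.1‖ + pmass A (x + l.vec) w := rfl

/-- Masses are nonnegative. [folklore] -/
theorem pmass_nonneg (A : Site d → Fin d → 𝔸) : ∀ (x : Site d) (w : List (Letter d)), 0 ≤ pmass A x w
  | _, [] => le_rfl
  | x, l :: w => by
    rw [pmass_cons]
    exact add_nonneg (norm_nonneg _) (pmass_nonneg A (x + l.vec) w)

/-- Concatenation. [folklore] -/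
theorem pmass_append (A : Site d → Fin d → 𝔸) : ∀ (x : Site d) (w₁ w₂ : List (Letter d)),
    pmass A x (w₁ ++ w₂) = pmass A x w₁ + pmass A (x + disp w₁) w₂
  | x, [], w₂ => by simp
  | x, l :: w₁, w₂ => by
    rw [List.cons_append, pmass_cons, pmass_cons, pmass_append A (x + l.vec) w₁ w₂, disp_cons, add_assoc, add_assoc]

/-- **THE ROTATED SUM IS MAJORISED BY THE MASS**: over a background with `‖V₀(b)‖, ‖V₀(b)⁻¹‖ ≤ 1` (class `U1`),
`‖(R_{0,x}A)(Γ)‖ ≤ Σ_{b⊂Γ}|A_b|` — the refinement of `B7Prop3GeneralRotated.norm_tsum_le` (`|Γ|·sup|A|`) that (139)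
needs (the rotations do not increase norms). [cite: Balaban1985Averaging, (139) p.39, (125)–(126) p.36] -/
theorem norm_tsum_le_pmass [NormOneClass 𝔸] {V₀ : Site d → Fin d → 𝔸ˣ} (hV₀ : ∀ x κ, V₀ x κ ∈ U1 𝔸)
    (A : Site d → Fin d → 𝔸) : ∀ (x : Site d) (w : List (Letter d)), ‖tsum V₀ A x w‖ ≤ pmass A x w
  | x, [] => by simp
  | x, l :: w => by
    rw [tsum_cons, pmass_cons]
    refine (norm_add_le _ _).trans (add_le_add ?_ ?_)
    · unfold tstep bsite
      split_ifs
      · exact le_rfl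
      · rw [norm_neg]
        exact norm_conjR_le (stepHol_mem hV₀ x l) _
    · exact (norm_conjR_le (stepHol_mem hV₀ x l) _).trans (norm_tsum_le_pmass hV₀ A (x + l.vec) w)

/-! ## §2 Monotone (positively oriented) walks: distinct bonds, hence mass ≤ the mass of any covering bond set -/

/-- The bonds `(site, direction)` of the contour `Γ` walked from `x`, in order. [folklore] -/
def bondsOf : Site d → List (Letter d) → List (Site d × Fin d)
  | _, [] => []
  | x, l :: w => (bsite x l, l.1) :: bondsOf (x + l.vec) w

/-- Empty contour. [folklore] -/
@[simp] theorem bondsOf_nil (x : Site d) : bondsOf x ([] : List (Letter d)) = [] := rfl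

/-- One letter. [folklore] -/
@[simp] theorem bondsOf_cons (x : Site d) (l : Letter d) (w : List (Letter d)) :
    bondsOf x (l :: w) = (bsite x l, l.1) :: bondsOf (x + l.vec) w := rfl

omit [NormedRing 𝔸] in
/-- A positively oriented letter moves by `+e_μ` and its bond sits at the current site. [folklore] -/
theorem vec_of_pos {l : Letter d} (hl : l.2 = true) : l.vec = e l.1 := by simp [Letter.vec, hl]

omit [NormedRing 𝔸] in
/-- … and its bond sits at the current site. [folklore] -/
theorem bsite_of_pos (x : Site d) {l : Letter d} (hl : l.2 = true) : bsite x l = x := by simp [bsite, hl]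

omit [NormedRing 𝔸] in
/-- `0 ≤ e_μ` coordinatewise. [folklore] -/
theorem e_nonneg (μ i : Fin d) : (0 : ℤ) ≤ e μ i := by
  rw [e_apply]
  split_ifs <;> norm_num

omit [NormedRing 𝔸] in
/-- The displacement of a positively oriented word is coordinatewise nonnegative. [folklore] -/
theorem disp_nonneg : ∀ {w : List (Letter d)}, (∀ l ∈ w, l.2 = true) → ∀ i, (0 : ℤ) ≤ disp w i
  | [], _, i => by simp [disp]
  | l :: w, hw, i => by
    rw [disp_cons, Pi.add_apply, vec_of_pos (hw l (by simp))]
    exact add_nonneg (e_nonneg _ _) (disp_nonneg (fun l' hl' => hw l' (by simp [hl'])) i)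

omit [NormedRing 𝔸] in
/-- THE SITES OF A MONOTONE WALK: every bond `(s, μ)` of a positively oriented word walked from `x` has
`s = x + v` with `0 ≤ v` and `v + e_μ ≤ disp Γ` coordinatewise (both endpoints lie in the box `[x, x + disp Γ]`).
[folklore] -/
theorem bondsOf_pos : ∀ {x : Site d} {w : List (Letter d)}, (∀ l ∈ w, l.2 = true) →
    ∀ b ∈ bondsOf x w, ∃ v : Site d, (∀ i, 0 ≤ v i) ∧ (∀ i, v i + e b.2 i ≤ disp w i) ∧ b.1 = x + v
  | x, [], _, b, hb => by simp at hb
  | x, l :: w, hw, b, hb => by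
    have hl : l.2 = true := hw l (by simp)
    have hw' : ∀ l' ∈ w, l'.2 = true := fun l' hl' => hw l' (by simp [hl'])
    rw [bondsOf_cons, List.mem_cons] at hb
    rcases hb with rfl | hb
    · refine ⟨0, fun i => le_rfl, fun i => ?_, by rw [bsite_of_pos x hl, add_zero]⟩
      rw [disp_cons, Pi.add_apply, vec_of_pos hl, Pi.zero_apply, zero_add]
      exact le_add_of_nonneg_right (disp_nonneg hw' i)
    · obtain ⟨v, hv0, hv1, hb1⟩ := bondsOf_pos hw' b hb
      refine ⟨l.vec + v, fun i => ?_, fun i => ?_, by rw [hb1, add_assoc]⟩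
      · rw [Pi.add_apply, vec_of_pos hl]
        exact add_nonneg (e_nonneg _ _) (hv0 i)
      · rw [disp_cons, Pi.add_apply, Pi.add_apply, add_assoc]
        exact add_le_add le_rfl (hv1 i)

omit [NormedRing 𝔸] in
/-- The first bond of a monotone walk is not revisited. [folklore] -/
theorem head_not_mem_bondsOf {x : Site d} {μ : Fin d} {w : List (Letter d)} (hw : ∀ l ∈ w, l.2 = true) :
    (x, μ) ∉ bondsOf (x + e μ) w := by
  intro h
  obtain ⟨v, hv0, -, hb1⟩ := bondsOf_pos hw (x, μ) h
  have h1 := congrArg (fun s : Site d => s μ) hb1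
  simp only [Pi.add_apply, e_apply, if_true] at h1
  have := hv0 μ
  omega

/-- **MASS OF A MONOTONE WALK ≤ MASS OF ANY COVERING BOND SET**: if every bond of a positively oriented contour walked
from `x` lies in the finite bond set `T`, then `Σ_{b⊂Γ}|A_b| ≤ Σ_{b∈T}|A_b|` (the walk's bonds are pairwise distinct).
[folklore] -/
theorem pmass_le_sum (A : Site d → Fin d → 𝔸) : ∀ (x : Site d) (w : List (Letter d)) (T : Finset (Site d × Fin d)),
    (∀ l ∈ w, l.2 = true) → (∀ b ∈ bondsOf x w, b ∈ T) → pmass A x w ≤ ∑ b ∈ T, ‖A b.1 b.2‖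
  | x, [], T, _, _ => by
    rw [pmass_nil]
    exact sum_nonneg fun b _ => norm_nonneg _
  | x, l :: w, T, hw, hT => by
    have hl : l.2 = true := hw l (by simp)
    have hw' : ∀ l' ∈ w, l'.2 = true := fun l' hl' => hw l' (by simp [hl'])
    have hhead : (x, l.1) ∈ T := by
      have h := hT (bsite x l, l.1) (by simp)
      rwa [bsite_of_pos x hl] at h
    have htail : ∀ b ∈ bondsOf (x + l.vec) w, b ∈ T.erase (x, l.1) := by
      intro b hb
      refine mem_erase.2 ⟨?_, hT b (by simp [hb])⟩
      rintro rfl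
      rw [vec_of_pos hl] at hb
      exact head_not_mem_bondsOf hw' hb
    rw [pmass_cons, bsite_of_pos x hl, ← add_sum_erase T (fun b => ‖A b.1 b.2‖) hhead]
    exact add_le_add le_rfl (pmass_le_sum A (x + l.vec) w (T.erase (x, l.1)) hw' htail)

end Mass

/-! ## §3 The contours of (115)∕(124)∕(125) live in `B(c₋) ∪ B(c₊)` -/

section Blocks

variable (L : ℕ)

/-- The straight segment `[x, x(c)]` is positively oriented. [folklore] -/
theorem seg_pos (κ : Fin d) : ∀ l ∈ seg κ (L : ℤ), l.2 = true := by
  intro l hl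
  rw [seg_natCast, List.mem_replicate] at hl
  rw [hl.2]

/-- The tree contour `Γ_{y,y+v}` of a nonnegative `v` is positively oriented. [folklore] -/
theorem treeWord_pos {v : Site d} (hv : ∀ i, 0 ≤ v i) : ∀ l ∈ treeWord v, l.2 = true := by
  intro l hl
  simp only [treeWord, List.mem_flatMap, List.mem_reverse, List.mem_finRange, true_and] at hl
  obtain ⟨κ, hκ⟩ := hl
  have hvκ : v κ = ((v κ).toNat : ℤ) := (Int.toNat_of_nonneg (hv κ)).symm
  rw [hvκ, seg_natCast, List.mem_replicate] at hκ
  rw [hκ.2]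

/-- `boxVec` is nonnegative. [folklore] -/
theorem boxVec_nonneg (r : Fin d → Fin L) (i : Fin d) : (0 : ℤ) ≤ boxVec L r i := by
  simp [boxVec]

/-- `boxVec < L` coordinatewise. [folklore] -/
theorem boxVec_lt (r : Fin d → Fin L) (i : Fin d) : boxVec L r i < L := by
  simp only [boxVec, Nat.cast_lt]
  exact (r i).isLt

/-- The block corner of `y + e_κ` is the corner of `y` translated by the coarse bond: `L·(y + e_κ) = L·y + Le_κ`.
[folklore] -/
theorem blockBase_add_e (y : Site d) (κ : Fin d) : blockBase L (y + e κ) = blockBase L y + (L : ℤ) • e κ := by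
  funext i
  simp [blockBase, e_apply, mul_add, zsmul_eq_mul]

/-- `l·e_κ = Pi.single κ l` (the two spellings of a lattice displacement). [folklore] -/
theorem zsmul_e (κ : Fin d) (l : ℤ) : l • e κ = Pi.single κ l := by
  funext i
  simp [e_apply, Pi.single_apply]

/-- A site `L·y + v` with `0 ≤ v < L` coordinatewise lies in the block `B(y)`. [folklore] -/
theorem mem_blockSites_of_box (hL : 0 < L) {y v : Site d} (h0 : ∀ i, 0 ≤ v i) (hv : ∀ i, v i < L) :
    blockBase L y + v ∈ blockSites L y := by
  haveI : NeZero L := ⟨hL.ne'⟩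
  exact (mem_blockSites_iff L y _).2 (blockMap_blockBase_add_of_lt L y v h0 hv)

/-- THE TREE CONTOUR LIVES IN ITS BLOCK: every bond of `Γ_{c₋,x}`, `x = L·y + r`, has both endpoints in `B(y)`, hence
lies in `qppBonds L (y, κ)` («b ⊂ B(c₋) ∪ B(c₊)») for every `κ`. [cite: Balaban1985Averaging, (14) p.19, (140) p.39] -/
theorem bondsOf_treeWord_mem (hL : 0 < L) (y : Site d) (κ : Fin d) (r : Fin d → Fin L) :
    ∀ b ∈ bondsOf (blockBase L y) (treeWord (boxVec L r)), b ∈ qppBonds L (y, κ) := by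
  intro b hb
  obtain ⟨v, hv0, hv1, hb1⟩ := bondsOf_pos (treeWord_pos (boxVec_nonneg L r)) b hb
  rw [disp_treeWord] at hv1
  have hvL : ∀ i, v i < L := fun i =>
    lt_of_le_of_lt ((le_add_of_nonneg_right (e_nonneg b.2 i)).trans (hv1 i)) (boxVec_lt L r i)
  have hveL : ∀ i, (v + e b.2) i < L := fun i => lt_of_le_of_lt (hv1 i) (boxVec_lt L r i)
  have hve0 : ∀ i, 0 ≤ (v + e b.2) i := fun i => add_nonneg (hv0 i) (e_nonneg _ _)
  rw [mem_qppBonds, twoBlocks]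
  refine ⟨mem_union_left _ ?_, mem_union_left _ ?_⟩
  · rw [hb1]
    exact mem_blockSites_of_box L hL hv0 hvL
  · rw [hb1, add_assoc, show v + Pi.single b.2 (1 : ℤ) = v + e b.2 from rfl]
    exact mem_blockSites_of_box L hL hve0 hveL

/-- The bonds of the straight segment `[x, x + ne_κ]`: `(x + le_κ, κ)`, `l < n`. [folklore] -/
theorem bondsOf_replicate (κ : Fin d) : ∀ (n : ℕ) (x : Site d),
    ∀ b ∈ bondsOf x (List.replicate n (κ, true)), ∃ l : ℕ, l < n ∧ b = (x + (l : ℤ) • e κ, κ)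
  | 0, x, b, hb => by simp at hb
  | n + 1, x, b, hb => by
    rw [List.replicate_succ, bondsOf_cons, List.mem_cons] at hb
    rcases hb with rfl | hb
    · exact ⟨0, Nat.succ_pos n, by simp [bsite]⟩
    · have hv : Letter.vec ((κ, true) : Letter d) = e κ := by simp [Letter.vec]
      rw [hv] at hb
      obtain ⟨l, hl, rfl⟩ := bondsOf_replicate κ n (x + e κ) b hb
      refine ⟨l + 1, Nat.succ_lt_succ hl, ?_⟩
      simp only [Nat.cast_succ, add_smul, one_smul, Prod.mk.injEq, and_true]
      abel

/-- THE STRAIGHT SEGMENT LIVES IN THE TWO BLOCKS: every bond of `[x, x(c)]`, `x ∈ B(c₋)`, lies in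
`qppBonds L (y, κ)` ([2] (1.8): `x(c) = x + Le_κ ∈ B(c₊)`; `B7BlockGeometry.line_mem_twoBlocks`).
[cite: Balaban1985Averaging, (140) p.39; Balaban1984PropagatorsI, (1.8) p.19] -/
theorem bondsOf_seg_mem (hL : 0 < L) {y x : Site d} (κ : Fin d) (hx : x ∈ blockSites L y) :
    ∀ b ∈ bondsOf x (seg κ (L : ℤ)), b ∈ qppBonds L (y, κ) := by
  intro b hb
  rw [seg_natCast] at hb
  obtain ⟨l, hl, rfl⟩ := bondsOf_replicate κ L x b hb
  rw [mem_qppBonds]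
  refine ⟨?_, ?_⟩
  · rw [zsmul_e]
    exact line_mem_twoBlocks hL κ hx (by positivity) (by exact_mod_cast hl.le)
  · dsimp only
    rw [zsmul_e, add_assoc, ← Pi.single_add, show (l : ℤ) + 1 = ((l + 1 : ℕ) : ℤ) by push_cast; ring,
      show (Pi.single κ (((l + 1 : ℕ) : ℤ)) : Site d) = Pi.single κ (((l + 1 : ℕ) : ℤ)) from rfl]
    exact line_mem_twoBlocks hL κ hx (by positivity) (by exact_mod_cast hl)

/-- The block corner lies in its block. [folklore] -/
theorem blockBase_mem (hL : 0 < L) (y : Site d) : blockBase L y ∈ blockSites L y := by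
  have h := mem_blockSites_of_box L hL (y := y) (v := 0) (fun _ => le_rfl)
    (fun _ => by rw [Pi.zero_apply]; exact_mod_cast hL)
  rwa [add_zero] at h

/-- The block sites `x = L·y + r` lie in `B(y)`. [folklore] -/
theorem blockBase_add_boxVec_mem (hL : 0 < L) (y : Site d) (r : Fin d → Fin L) :
    blockBase L y + boxVec L r ∈ blockSites L y :=
  mem_blockSites_of_box L hL (boxVec_nonneg L r) (boxVec_lt L r)

/-! ### The masses of the four pieces of the loop `Γ_{c,x} ∪ (−c)` and of the segment `[x, x(c)]` -/

variable {𝔸 : Type*} [NormedRing 𝔸]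

/-- THE TWO-BLOCK MASS `Σ_{b ⊂ B(c₋)∪B(c₊)} |A_b| = Lᵈ·(Q″|A|)_c` ((140)). [cite: Balaban1985Averaging, (140) p.39] -/
theorem sum_qppBonds_eq_Qdd (hL : 0 < L) (A : Site d → Fin d → 𝔸) (y : Site d) (κ : Fin d) :
    ∑ b ∈ qppBonds L (y, κ), ‖A b.1 b.2‖ = (L : ℝ) ^ d * Qdd L (fun b => ‖A b.1 b.2‖) (y, κ) := by
  have hL0 : ((L : ℝ) ^ d) ≠ 0 := pow_ne_zero d (by exact_mod_cast hL.ne')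
  rw [Qdd_apply', ← mul_assoc, mul_inv_cancel₀ hL0, one_mul]

/-- Mass of the tree contour `Γ_{c₋,x}` `≤` the two-block mass. [cite: Balaban1985Averaging, (139)-(140) p.39] -/
theorem pmass_treeWord_le (hL : 0 < L) (A : Site d → Fin d → 𝔸) (y : Site d) (κ : Fin d) (r : Fin d → Fin L) :
    pmass A (blockBase L y) (treeWord (boxVec L r)) ≤ ∑ b ∈ qppBonds L (y, κ), ‖A b.1 b.2‖ :=
  pmass_le_sum A _ _ _ (treeWord_pos (boxVec_nonneg L r)) (bondsOf_treeWord_mem L hL y κ r)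

/-- Mass of the tree contour `Γ_{c₊,x′}` in the second block `≤` the two-block mass. [cite: Balaban1985Averaging, (139)-(140) p.39] -/
theorem pmass_treeWord_le' (hL : 0 < L) (A : Site d → Fin d → 𝔸) (y : Site d) (κ : Fin d) (r : Fin d → Fin L) :
    pmass A (blockBase L y + (L : ℤ) • e κ) (treeWord (boxVec L r)) ≤ ∑ b ∈ qppBonds L (y, κ), ‖A b.1 b.2‖ := by
  rw [← blockBase_add_e]
  refine pmass_le_sum A _ _ _ (treeWord_pos (boxVec_nonneg L r)) fun b hb => ?_
  -- the tree contour of the second block: both endpoints in `B(c₊) = B(y + e_κ)`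
  obtain ⟨v, hv0, hv1, hb1⟩ := bondsOf_pos (treeWord_pos (boxVec_nonneg L r)) b hb
  rw [disp_treeWord] at hv1
  have hvL : ∀ i, v i < L := fun i =>
    lt_of_le_of_lt ((le_add_of_nonneg_right (e_nonneg b.2 i)).trans (hv1 i)) (boxVec_lt L r i)
  have hveL : ∀ i, (v + e b.2) i < L := fun i => lt_of_le_of_lt (hv1 i) (boxVec_lt L r i)
  have hve0 : ∀ i, 0 ≤ (v + e b.2) i := fun i => add_nonneg (hv0 i) (e_nonneg _ _)
  rw [mem_qppBonds, twoBlocks, show ((y, κ) : ZdEdge d).1 + Pi.single ((y, κ) : ZdEdge d).2 (1 : ℤ) = y + e κ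
    from rfl]
  refine ⟨mem_union_right _ ?_, mem_union_right _ ?_⟩
  · rw [hb1]
    exact mem_blockSites_of_box L hL hv0 hvL
  · rw [hb1, add_assoc, show v + Pi.single b.2 (1 : ℤ) = v + e b.2 from rfl]
    exact mem_blockSites_of_box L hL hve0 hveL

/-- Mass of the straight segment `[x, x(c)]` from a site of `B(c₋)` `≤` the two-block mass (in particular for the
coarse bond `c` itself, `x = c₋`). [cite: Balaban1985Averaging, (139)-(140) p.39] -/
theorem pmass_seg_le (hL : 0 < L) (A : Site d → Fin d → 𝔸) {y x : Site d} (κ : Fin d) (hx : x ∈ blockSites L y) :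
    pmass A x (seg κ (L : ℤ)) ≤ ∑ b ∈ qppBonds L (y, κ), ‖A b.1 b.2‖ :=
  pmass_le_sum A _ _ _ (seg_pos L κ) (bondsOf_seg_mem L hL κ hx)

/-- The mass of a straight segment, explicitly: `Σ_{l<n} |A(x + le_κ, κ)|`. [folklore] -/
theorem pmass_replicate (A : Site d → Fin d → 𝔸) (κ : Fin d) : ∀ (n : ℕ) (x : Site d),
    pmass A x (List.replicate n (κ, true)) = ∑ l ∈ range n, ‖A (x + (l : ℤ) • e κ) κ‖
  | 0, x => by simp
  | n + 1, x => by
    have hv : Letter.vec ((κ, true) : Letter d) = e κ := by simp [Letter.vec]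
    rw [List.replicate_succ, pmass_cons, pmass_replicate A κ n, sum_range_succ', hv]
    simp only [bsite, if_true, Nat.cast_zero, zero_smul, add_zero, Nat.cast_succ, add_smul, one_smul]
    rw [add_comm]
    refine congrArg₂ (· + ·) (sum_congr rfl fun l _ => ?_) rfl
    rw [add_assoc, add_comm (e κ)]

end Blocks

end Summit.QuantumFields.BalabanUV.T4Continuum.ShellMeasureAveragePathMass

end
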